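import Literature.AlgebraicGeometry.Modules.DeterminantCocycle
import Literature.AlgebraicGeometry.Modules.AdaptedFrame
import Mathlib.LinearAlgebra.Matrix.Block
import HarnessLib

/-!
# The determinant class is multiplicative on short exact sequences

For a short exact sequence `0 → E₁ → E₂ → E₃ → 0` of finite locally free `𝒪_X`-modules on a
scheme `X`,

  `detClass h₂ = detClass h₁ * detClass h₃` in `Ȟ¹(X, 𝒪_X^×)` (`detClass_mul_of_shortExact`),

the cocycle form of `Λ^{top} E₂ ≅ Λ^{top} E₁ ⊗ Λ^{top} E₃` (Hartshorne II Ex. 5.16 (d)) — the additivity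
that makes `det` descend to `K₀(X)` (Hartshorne II Ex. 6.11; Fulton §15.1). Proof: near every point
choose frames of `E₁` and `E₃` and local lifts of the basis of `E₃` (`E₂ → E₃` is an epimorphism),
shrink to a common open `adaptedOpen x`, and take the adapted frame of `E₂`
(`Modules/AdaptedFrame.lean`); its transition matrices are block upper triangular with diagonal
blocks the transition matrices of `E₁` and `E₃` (`transition_adapted_inl`,
`transition_adapted_inr_inr`), so their determinants multiply (`det_blockTriangular_fin`,
Mathlib's `Matrix.det_fromBlocks_zero₂₁`), and the determinant class may be computed in any frame
system (`detClass_eq_mk`). Everything is proved; no named facts.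

## References

* R. Hartshorne, *Algebraic Geometry*, GTM 52 (1977), II Ex. 5.16 (d), II Ex. 6.11.
  [Hartshorne1977]
* W. Fulton, *Intersection theory*, 2nd ed. (1998), §15.1. [Fulton1998]
-/

noncomputable section

open CategoryTheory AlgebraicGeometry Opposite TopologicalSpace Limits

namespace Literature.AlgebraicGeometry.Modules

open Literature.AlgebraicGeometry.Motives

universe u

/-! ### A determinant identity for block triangular matrices indexed by `Fin n₁ ⊕ Fin n₃` -/

/-- The determinant of a block upper triangular matrix indexed by `Fin n₁ ⊕ Fin n₃`, read as a square
matrix through `finSumFinEquiv` (and `Fin.cast` along equalities of sizes), is the product of the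
determinants of its diagonal blocks. [folklore] -/
theorem det_blockTriangular_fin {R : Type*} [CommRing R] {n₁ n₃ m₁ m₃ : ℕ}
    (M : Matrix (Fin n₁ ⊕ Fin n₃) (Fin m₁ ⊕ Fin m₃) R) (h₁ : n₁ = m₁) (h₃ : n₃ = m₃)
    (h : n₁ + n₃ = m₁ + m₃) (hzero : ∀ a b, M (Sum.inr a) (Sum.inl b) = 0) :
    (Matrix.of fun a b => M (finSumFinEquiv.symm a) (finSumFinEquiv.symm (Fin.cast h b))).det =
      (Matrix.of fun a b => M (Sum.inl a) (Sum.inl (Fin.cast h₁ b))).det *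
        (Matrix.of fun a b => M (Sum.inr a) (Sum.inr (Fin.cast h₃ b))).det := by
  subst h₁ h₃
  have hM : M = Matrix.fromBlocks M.toBlocks₁₁ M.toBlocks₁₂ 0 M.toBlocks₂₂ := by
    ext (a | a) (b | b)
    · rfl
    · rfl
    · exact hzero a b
    · rfl
  have e1 : (Matrix.of fun a b => M (finSumFinEquiv.symm a) (finSumFinEquiv.symm (Fin.cast h b))) =
      Matrix.reindex finSumFinEquiv finSumFinEquiv M := rfl
  conv_lhs => rw [e1, Matrix.det_reindex_self, hM, Matrix.det_fromBlocks_zero₂₁]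
  rfl

variable {X : Scheme.{u}}

/-! ### Local lifts and the adapted frame system -/

section Adapted

open scoped Classical

variable {S : ShortComplex X.Modules} (hS : S.ShortExact) (h₁ : IsFiniteLocallyFree S.X₁)
  (h₃ : IsFiniteLocallyFree S.X₃)

include hS in
/-- The basis sections of the chosen frame of `E₃` at `x` lift locally through the epimorphism
`E₂ → E₃`. [folklore] -/
lemma exists_lift (x : X) (k : TrivIndex h₃ x) :
    ∃ (V : X.Opens) (hV : V ≤ trivNbhd h₃ x), x ∈ V ∧ ∃ s : Γ(S.X₂, V),
      S.g.app V s = S.X₃.presheaf.map (homOfLE hV).op (basisSection (trivFrame h₃ x) k) :=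
  haveI := hS.epi_g
  Scheme.Modules.exists_app_eq_of_epi S.g _ _ x (mem_trivNbhd h₃ x)

/-- The open on which the `k`-th basis section of `E₃` at `x` is lifted. [folklore] -/
def liftOpen (x : X) (k : TrivIndex h₃ x) : X.Opens :=
  (exists_lift hS h₃ x k).choose

/-- `liftOpen ≤ U₃`. [folklore] -/
lemma liftOpen_le (x : X) (k : TrivIndex h₃ x) : liftOpen hS h₃ x k ≤ trivNbhd h₃ x :=
  (exists_lift hS h₃ x k).choose_spec.fst

/-- `x ∈ liftOpen`. [folklore] -/
lemma mem_liftOpen (x : X) (k : TrivIndex h₃ x) : x ∈ liftOpen hS h₃ x k :=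
  (exists_lift hS h₃ x k).choose_spec.snd.1

/-- The chosen lift of the `k`-th basis section of `E₃` at `x`. [folklore] -/
def liftSec (x : X) (k : TrivIndex h₃ x) : Γ(S.X₂, liftOpen hS h₃ x k) :=
  (exists_lift hS h₃ x k).choose_spec.snd.2.choose

/-- The chosen lift maps to the (restricted) basis section. [folklore] -/
lemma liftSec_spec (x : X) (k : TrivIndex h₃ x) :
    S.g.app _ (liftSec hS h₃ x k) =
      S.X₃.presheaf.map (homOfLE (liftOpen_le hS h₃ x k)).op (basisSection (trivFrame h₃ x) k) :=
  (exists_lift hS h₃ x k).choose_spec.snd.2.choose_spec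

/-- **The adapted open at `x`**: inside the framed neighbourhoods of `E₁` and `E₃` and all the
`liftOpen x k`. [folklore] -/
def adaptedOpen (x : X) : X.Opens :=
  trivNbhd h₁ x ⊓ trivNbhd h₃ x ⊓ ⨅ k, liftOpen hS h₃ x k

/-- `x ∈ adaptedOpen x`. [folklore] -/
lemma mem_adaptedOpen (x : X) : x ∈ adaptedOpen hS h₁ h₃ x := by
  refine ⟨⟨mem_trivNbhd h₁ x, mem_trivNbhd h₃ x⟩, ?_⟩
  change x ∈ ((⨅ k, liftOpen hS h₃ x k : X.Opens) : Set X)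
  rw [Opens.coe_iInf]
  exact Set.mem_iInter.mpr (mem_liftOpen hS h₃ x)

/-- `adaptedOpen x ≤ U₁`. [folklore] -/
lemma adaptedOpen_le₁ (x : X) : adaptedOpen hS h₁ h₃ x ≤ trivNbhd h₁ x :=
  inf_le_left.trans inf_le_left

/-- `adaptedOpen x ≤ U₃`. [folklore] -/
lemma adaptedOpen_le₃ (x : X) : adaptedOpen hS h₁ h₃ x ≤ trivNbhd h₃ x :=
  inf_le_left.trans inf_le_right

/-- `adaptedOpen x ≤ liftOpen x k`. [folklore] -/
lemma adaptedOpen_le_lift (x : X) (k : TrivIndex h₃ x) :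
    adaptedOpen hS h₁ h₃ x ≤ liftOpen hS h₃ x k :=
  inf_le_right.trans (iInf_le _ k)

/-- The frame of `E₁` restricted to the adapted open. [folklore] -/
def frame₁ (x : X) : SheafOfModules.free (TrivIndex h₁ x) ≅ S.X₁.over (adaptedOpen hS h₁ h₃ x) :=
  SheafOfModules.restrictTrivialisation (R := X.ringCatSheaf) (homOfLE (adaptedOpen_le₁ hS h₁ h₃ x))
    (trivFrame h₁ x)

/-- The frame of `E₃` restricted to the adapted open. [folklore] -/
def frame₃ (x : X) : SheafOfModules.free (TrivIndex h₃ x) ≅ S.X₃.over (adaptedOpen hS h₁ h₃ x) :=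
  SheafOfModules.restrictTrivialisation (R := X.ringCatSheaf) (homOfLE (adaptedOpen_le₃ hS h₁ h₃ x))
    (trivFrame h₃ x)

/-- The lifts restricted to the adapted open. [folklore] -/
def adaptedLift (x : X) (k : TrivIndex h₃ x) : Γ(S.X₂, adaptedOpen hS h₁ h₃ x) :=
  S.X₂.presheaf.map (homOfLE (adaptedOpen_le_lift hS h₁ h₃ x k)).op (liftSec hS h₃ x k)

/-- The restricted lifts map to the basis sections of the restricted frame of `E₃`. [folklore] -/
lemma adaptedLift_spec (x : X) (k : TrivIndex h₃ x) :
    S.g.app (adaptedOpen hS h₁ h₃ x) (adaptedLift hS h₁ h₃ x k) = basisSection (frame₃ hS h₁ h₃ x) k := by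
  rw [adaptedLift, Scheme.Modules.Hom.app_map_apply, liftSec_spec, presheaf_map_map, frame₃,
    basisSection_restrictTrivialisation]
  rfl

/-- **The adapted frame system of `E₂`** attached to the short exact sequence. [folklore] -/
def adaptedFrameSystem : FrameSystem S.X₂ where
  U := adaptedOpen hS h₁ h₃
  mem := mem_adaptedOpen hS h₁ h₃
  I x := TrivIndex h₁ x ⊕ TrivIndex h₃ x
  rank x := Nat.card (TrivIndex h₁ x) + Nat.card (TrivIndex h₃ x)
  enum x := ((Finite.equivFin (TrivIndex h₁ x)).sumCongr (Finite.equivFin (TrivIndex h₃ x))).trans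
    finSumFinEquiv
  frame x := adaptedFrame hS (frame₁ hS h₁ h₃ x) (frame₃ hS h₁ h₃ x) (adaptedLift hS h₁ h₃ x)
    (adaptedLift_spec hS h₁ h₃ x)

/-! ### The transition matrices of the adapted frames are block upper triangular -/

variable {x y : X} {V : X.Opens} (hx : V ≤ adaptedOpen hS h₁ h₃ x) (hy : V ≤ adaptedOpen hS h₁ h₃ y)

/-- `f` kills nothing new: `g (f b) = 0` on sections. [folklore] -/
lemma g_app_f_app (W : X.Opens) (b : Γ(S.X₁, W)) : S.g.app W (S.f.app W b) = 0 := by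
  change (S.f ≫ S.g).app W b = 0
  rw [S.zero, Scheme.Modules.Hom.zero_app]
  rfl

/-- **First block column**: in the adapted frames, the coordinates of the `E₁`-part of the frame at
`y` are `(T(e¹_x, e¹_y), 0)`. [folklore] -/
theorem transition_adapted_inl (j : TrivIndex h₁ y) (s : TrivIndex h₁ x ⊕ TrivIndex h₃ x) :
    transition ((adaptedFrameSystem hS h₁ h₃).frame x) ((adaptedFrameSystem hS h₁ h₃).frame y)
        (homOfLE hx) (homOfLE hy) s (Sum.inl j) =
      Sum.elim (fun i => transition (trivFrame h₁ x) (trivFrame h₁ y)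
        (homOfLE (hx.trans (adaptedOpen_le₁ hS h₁ h₃ x)))
        (homOfLE (hy.trans (adaptedOpen_le₁ hS h₁ h₃ y))) i j) 0 s := by
  rw [transition_apply]
  refine coord_adaptedFrame_of_eq_sum hS _ _ _ (adaptedLift_spec hS h₁ h₃ x) (homOfLE hx) _ _ _ ?_ s
  change S.X₂.presheaf.map (homOfLE hy).op (basisSection (E := S.X₂) (adaptedFrame hS _ _ _
    (adaptedLift_spec hS h₁ h₃ y)) (Sum.inl j)) = _
  rw [basisSection_adaptedFrame_inl, ← Scheme.Modules.Hom.app_map_apply,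
    map_basisSection_eq_sum_transition (frame₁ hS h₁ h₃ x) (frame₁ hS h₁ h₃ y) (homOfLE hx)
      (homOfLE hy) j, map_sum]
  simp only [Pi.zero_apply, zero_smul, Finset.sum_const_zero, add_zero, Scheme.Modules.Hom.app_smul,
    Scheme.Modules.Hom.app_map_apply]
  refine Finset.sum_congr rfl fun i _ => ?_
  rw [frame₁, frame₁, transition_restrictTrivialisation]
  rfl

/-- **Second diagonal block**: the `E₃`-coordinates of the lifted part of the frame at `y` are
`T(e³_x, e³_y)`. [folklore] -/
theorem transition_adapted_inr_inr (k : TrivIndex h₃ x) (l : TrivIndex h₃ y) :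
    transition ((adaptedFrameSystem hS h₁ h₃).frame x) ((adaptedFrameSystem hS h₁ h₃).frame y)
        (homOfLE hx) (homOfLE hy) (Sum.inr k) (Sum.inr l) =
      transition (trivFrame h₃ x) (trivFrame h₃ y) (homOfLE (hx.trans (adaptedOpen_le₃ hS h₁ h₃ x)))
        (homOfLE (hy.trans (adaptedOpen_le₃ hS h₁ h₃ y))) k l := by
  set T := transition ((adaptedFrameSystem hS h₁ h₃).frame x) ((adaptedFrameSystem hS h₁ h₃).frame y)
    (homOfLE hx) (homOfLE hy) with hT
  -- expand the lifted basis section of the frame at `y` in the frame at `x`, and apply `g`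
  have hexp := map_basisSection_eq_sum_transition (I := TrivIndex h₁ x ⊕ TrivIndex h₃ x)
    ((adaptedFrameSystem hS h₁ h₃).frame x) ((adaptedFrameSystem hS h₁ h₃).frame y) (homOfLE hx)
    (homOfLE hy) (Sum.inr l)
  have hgexp := congrArg (S.g.app V) hexp
  rw [map_sum, Fintype.sum_sum_type] at hgexp
  change S.g.app V (S.X₂.presheaf.map (homOfLE hy).op (basisSection (E := S.X₂) (adaptedFrame hS _ _ _
    (adaptedLift_spec hS h₁ h₃ y)) (Sum.inr l))) =
    ∑ i, S.g.app V (T (Sum.inl i) (Sum.inr l) • S.X₂.presheaf.map (homOfLE hx).op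
      (basisSection (E := S.X₂) (adaptedFrame hS _ _ _ (adaptedLift_spec hS h₁ h₃ x)) (Sum.inl i))) +
    ∑ k, S.g.app V (T (Sum.inr k) (Sum.inr l) • S.X₂.presheaf.map (homOfLE hx).op
      (basisSection (E := S.X₂) (adaptedFrame hS _ _ _ (adaptedLift_spec hS h₁ h₃ x)) (Sum.inr k)))
    at hgexp
  simp only [basisSection_adaptedFrame_inl, basisSection_adaptedFrame_inr,
    Scheme.Modules.Hom.app_smul, Scheme.Modules.Hom.app_map_apply, g_app_f_app, map_zero,
    smul_zero, Finset.sum_const_zero, zero_add, adaptedLift_spec] at hgexp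
  -- `hgexp : b³_{y,l}|_V = ∑_k T_{kl} b³_{x,k}|_V` in the restricted frames of `E₃`
  have hc := congrArg (fun s => coord (frame₃ hS h₁ h₃ x) (homOfLE hx) s k) hgexp
  simp only [coord_sum_smul_basisSection] at hc
  rw [← hc, ← transition_apply, frame₃, frame₃, transition_restrictTrivialisation]
  rfl

/-- **The adapted cocycle is the product of the determinant cocycles of `E₁` and `E₃`.** [folklore] -/
theorem cocycle_adaptedFrameSystem_g :
    (adaptedFrameSystem hS h₁ h₃).cocycle.g x y V hx hy =
      (detCocycle h₁).g x y V (hx.trans (adaptedOpen_le₁ hS h₁ h₃ x))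
          (hy.trans (adaptedOpen_le₁ hS h₁ h₃ y)) *
        (detCocycle h₃).g x y V (hx.trans (adaptedOpen_le₃ hS h₁ h₃ x))
          (hy.trans (adaptedOpen_le₃ hS h₁ h₃ y)) := by
  rcases subsingleton_or_nontrivial Γ(X, V) with hV | hV
  · exact Subsingleton.elim _ _
  -- notation
  let ε₁x := Finite.equivFin (TrivIndex h₁ x)
  let ε₁y := Finite.equivFin (TrivIndex h₁ y)
  let ε₃x := Finite.equivFin (TrivIndex h₃ x)
  let ε₃y := Finite.equivFin (TrivIndex h₃ y)
  let k₁x : V ⟶ trivNbhd h₁ x := homOfLE (hx.trans (adaptedOpen_le₁ hS h₁ h₃ x))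
  let k₁y : V ⟶ trivNbhd h₁ y := homOfLE (hy.trans (adaptedOpen_le₁ hS h₁ h₃ y))
  let k₃x : V ⟶ trivNbhd h₃ x := homOfLE (hx.trans (adaptedOpen_le₃ hS h₁ h₃ x))
  let k₃y : V ⟶ trivNbhd h₃ y := homOfLE (hy.trans (adaptedOpen_le₃ hS h₁ h₃ y))
  have r₁ : Nat.card (TrivIndex h₁ x) = Nat.card (TrivIndex h₁ y) :=
    rank_eq_of_nontrivial (trivFrame h₁ x) (trivFrame h₁ y) ε₁x ε₁y k₁x k₁y
  have r₃ : Nat.card (TrivIndex h₃ x) = Nat.card (TrivIndex h₃ y) :=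
    rank_eq_of_nontrivial (trivFrame h₃ x) (trivFrame h₃ y) ε₃x ε₃y k₃x k₃y
  have r : Nat.card (TrivIndex h₁ x) + Nat.card (TrivIndex h₃ x) =
      Nat.card (TrivIndex h₁ y) + Nat.card (TrivIndex h₃ y) := by rw [r₁, r₃]
  change transitionDet ((adaptedFrameSystem hS h₁ h₃).frame x) ((adaptedFrameSystem hS h₁ h₃).frame y)
      ((ε₁x.sumCongr ε₃x).trans finSumFinEquiv) ((ε₁y.sumCongr ε₃y).trans finSumFinEquiv)
      (homOfLE hx) (homOfLE hy) =
    transitionDet (trivFrame h₁ x) (trivFrame h₁ y) ε₁x ε₁y k₁x k₁y *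
      transitionDet (trivFrame h₃ x) (trivFrame h₃ y) ε₃x ε₃y k₃x k₃y
  rw [transitionDet_of_eq _ _ _ _ r, transitionDet_of_eq _ _ _ _ r₁, transitionDet_of_eq _ _ _ _ r₃]
  -- the transition matrix of the adapted frames, reindexed by `Fin n₁ ⊕ Fin n₃`
  let M : Matrix (Fin (Nat.card (TrivIndex h₁ x)) ⊕ Fin (Nat.card (TrivIndex h₃ x)))
      (Fin (Nat.card (TrivIndex h₁ y)) ⊕ Fin (Nat.card (TrivIndex h₃ y))) Γ(X, V) :=
    (transition ((adaptedFrameSystem hS h₁ h₃).frame x) ((adaptedFrameSystem hS h₁ h₃).frame y)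
      (homOfLE hx) (homOfLE hy)).submatrix (Sum.map ε₁x.symm ε₃x.symm) (Sum.map ε₁y.symm ε₃y.symm)
  have key := det_blockTriangular_fin M r₁ r₃ r (fun a b => by
    change transition ((adaptedFrameSystem hS h₁ h₃).frame x) ((adaptedFrameSystem hS h₁ h₃).frame y)
      (homOfLE hx) (homOfLE hy) (Sum.inr _) (Sum.inl _) = 0
    rw [transition_adapted_inl]
    rfl)
  have hA : (Matrix.of fun a b => stdTransition ((adaptedFrameSystem hS h₁ h₃).frame x)
      ((adaptedFrameSystem hS h₁ h₃).frame y) ((ε₁x.sumCongr ε₃x).trans finSumFinEquiv)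
      ((ε₁y.sumCongr ε₃y).trans finSumFinEquiv) (homOfLE hx) (homOfLE hy) a (Fin.cast r b)) =
      Matrix.of fun a b => M (finSumFinEquiv.symm a) (finSumFinEquiv.symm (Fin.cast r b)) := by
    ext a b
    rfl
  have hB : (Matrix.of fun a b => stdTransition (trivFrame h₁ x) (trivFrame h₁ y) ε₁x ε₁y k₁x k₁y a
      (Fin.cast r₁ b)) = Matrix.of fun a b => M (Sum.inl a) (Sum.inl (Fin.cast r₁ b)) := by
    ext a b
    change _ = transition ((adaptedFrameSystem hS h₁ h₃).frame x)
      ((adaptedFrameSystem hS h₁ h₃).frame y) (homOfLE hx) (homOfLE hy) (Sum.inl _) (Sum.inl _)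
    rw [Matrix.of_apply, stdTransition_apply, transition_adapted_inl]
    rfl
  have hC : (Matrix.of fun a b => stdTransition (trivFrame h₃ x) (trivFrame h₃ y) ε₃x ε₃y k₃x k₃y a
      (Fin.cast r₃ b)) = Matrix.of fun a b => M (Sum.inr a) (Sum.inr (Fin.cast r₃ b)) := by
    ext a b
    change _ = transition ((adaptedFrameSystem hS h₁ h₃).frame x)
      ((adaptedFrameSystem hS h₁ h₃).frame y) (homOfLE hx) (homOfLE hy) (Sum.inr _) (Sum.inr _)
    rw [Matrix.of_apply, stdTransition_apply, transition_adapted_inr_inr]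
  rw [hA, hB, hC]
  exact key

end Adapted

/-! ### Additivity of the determinant class -/

/-- **`[det E₂] = [det E₁] · [det E₃]` for a short exact sequence `0 → E₁ → E₂ → E₃ → 0` of finite
locally free `𝒪_X`-modules** (Hartshorne II Ex. 5.16 (d), in `Ȟ¹(X, 𝒪_X^×)`).
[cite: Hartshorne1977, II Ex. 5.16 (d)] -/
theorem detClass_mul_of_shortExact {S : ShortComplex X.Modules} (hS : S.ShortExact)
    (h₁ : IsFiniteLocallyFree S.X₁) (h₂ : IsFiniteLocallyFree S.X₂)
    (h₃ : IsFiniteLocallyFree S.X₃) : detClass h₂ = detClass h₁ * detClass h₃ := by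
  rw [detClass_eq_mk h₂ (adaptedFrameSystem hS h₁ h₃), detClass, detClass, ← CechPic.mk_mul]
  refine CechPic.sound (UnitCocycle.equiv_of_eq _ _ (adaptedOpen hS h₁ h₃)
    (mem_adaptedOpen hS h₁ h₃) (fun x => le_rfl)
    (fun x => le_inf (adaptedOpen_le₁ hS h₁ h₃ x) (adaptedOpen_le₃ hS h₁ h₃ x)) ?_)
  intro x y V hx hy
  exact (cocycle_adaptedFrameSystem_g hS h₁ h₃ hx hy).symm

end Literature.AlgebraicGeometry.Modules

end
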